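import Mathlib
import Summits.ValiantsHypothesis.ValiantsHypothesis.Theorems.FreeSubtorusSubtorusCovering
import Summits.ValiantsHypothesis.ValiantsHypothesis.Theorems.FreeSubtorusOrbitDimensionBoundStubAbsorbingSacrificeTerminalTools
import Summits.ValiantsHypothesis.ValiantsHypothesis.Theorems.FreeSubtorusOrbitDimensionBoundStubAbsorbingSacrificePin
import Summits.ValiantsHypothesis.ValiantsHypothesis.Theorems.FreeSubtorusOrbitDimensionBoundStubAbsorbingSacrificeLifts
import Summits.ValiantsHypothesis.ValiantsHypothesis.Theorems.FreeSubtorusOrbitDimensionBoundStubAbsorbingSacrificeExtension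
import HarnessLib

/-!
# Crux `OrbitDimensionBound` (stmt-ValiantsHypothesis-16133), line `affine_multiple`, stub `stub_absorbingSacrifice`
# — piece (β3): the PINNED TERMINAL STEP (uniform over the four pin positions)

Helper toward the registered stub `stub_absorbingSacrifice` (lead: val-lit-p6 g11; split SPEC
`HOME/lmr/SPEC-p6g11-16133-stub2-split.md`, piece (β3)); `--supports stmt-ValiantsHypothesis-16133 --as helper`;
0 definitions / 0 named facts.

**`terminal_pinned`** (header = SPEC (β3) verbatim).  Input: a `T_Λ`-equivariant affine representation `B` of
`per_{n'+s} · q` in relabelled coordinates (free block `castAdd`, sacrificed pairs `natAdd`), `q` a linear form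
with NO free × free support, integer expansions `har/hac` of the free columns of `Λ` through the sacrificed
differences (the floor's `torusExtension_explicit` input), and ONE support position `p₀` of `q` with its pin datum
`hpin`: `p₀` on the sacrificed diagonal, or in a sacrificed row × free column with constant coefficients
`(α, …, α; α, …, α + N at l₀)`, or in a free row × sacrificed column with `(α, …, α − N at k₀; α, …, α)`, or
off the diagonal of the sacrificed block with constant coefficients on both pairs.  Output: a representation of
`per_{n'}` of the same size, equivariant under the PER-INVARIANT torus `T¹ = torusGen n' 1 𝟙` (spelled out).

Recipe (all by name): the unpinned substitution `g₀` (free ↦ `X`, sacrificed diagonal ↦ `1`, rest ↦ `0`; the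
floor's `Fin.addCases` term); `hfree` puts every variable of `q` on a constant of `g₀`
(`coeff_single_ne_zero_of_mem_vars`), so `exists_pin_aeval_eq_C_ne_zero` pins `p₀` to `u₀ ≠ 0` with
`aeval g q = C κ`, `κ ≠ 0`; the permanent absorbs the pin — `aeval_perPoly_absorbing_diag` (diagonal pin,
`t = 1[j₁ ↦ u₀]`; free-row pin, `t = 1`), `…_row j₀` (sacrificed-row pin), `…_col j₁` (off-diagonal pin) — so
`det (B.map (aeval g)) = C (T κ) · per_{n'}`; affine entries by `totalDegree_aeval_le_one`; lifts of `T¹` by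
`isEquivariantDetRepr_subst_const`: for `∏ δ ∏ ε = 1` take roots with `∏ dr ∏ er = 1`
(`exists_roots_prod_eq_one`), extend by `torusExtension_pin_offDiag/sacRow_freeCol/freeRow_sacCol` whose
character condition `hχ` is exactly what the α-clauses of `hpin` give once `∏ dr ∏ er = 1` (`Finset.prod_zpow`);
a non-zero constant of `g` sits at the pin or on the sacrificed diagonal, where the extension is `1`; finally the
constant `T κ` is rescaled away (`exists_rescale_C`, the line's `Multiple.exists_rescale` re-proved here since
`Cruxes/` is not importable).

Honest framing: plumbing inside one stub; `stub_absorbingSacrifice`, the crux `OrbitDimensionBound` and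
`VP ≠ VNP` remain OPEN; nothing here is progress on them.
-/

set_option linter.dupNamespace false
set_option autoImplicit false

noncomputable section

namespace Summit.ValiantsHypothesis.ValiantsHypothesis.Theorems.FreeSubtorusOrbitDimensionBound.AbsorbingSacrifice

open Literature.Computability.AlgebraicComplexity MvPolynomial Finset
open Summit.ValiantsHypothesis.ValiantsHypothesis.Theorems.FreeSubtorusSubtorusCovering (totalDegree_aeval_le_one)

/-! ### The pinned terminal step -/

/-- **Pinned terminal step of `stub_absorbingSacrifice`** (piece (β3) of the lead's split; see the
module docstring for the recipe and the four pin positions). [cite: LandsbergRessayre2017, Thm. 2.8, §6] -/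
theorem terminal_pinned (n' s r m : ℕ) (Λ : Fin r → (Fin (n' + s) ⊕ Fin (n' + s)) → ℤ)
    (B : Matrix (Fin m) (Fin m) (MvPolynomial (Fin (n' + s) × Fin (n' + s)) ℂ))
    (q : MvPolynomial (Fin (n' + s) × Fin (n' + s)) ℂ) (hq : q.IsHomogeneous 1)
    (hB : IsEquivariantDetRepr (Subgroup.closure
        {γ : Matrix.GeneralLinearGroup (Fin (n' + s) × Fin (n' + s)) ℂ |
          ∃ d e : Fin (n' + s) → ℂˣ,
            (∀ i, (∏ k, (d k) ^ (Λ i (Sum.inl k))) * (∏ l, (e l) ^ (Λ i (Sum.inr l))) = 1) ∧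
            (γ : Matrix (Fin (n' + s) × Fin (n' + s)) (Fin (n' + s) × Fin (n' + s)) ℂ) =
              Matrix.diagonal (fun p => (d p.1 : ℂ) * (e p.2 : ℂ))})
      (perPoly (Fin (n' + s)) ℂ * q) B)
    (hm : 1 ≤ m) (hn' : 1 ≤ n') (N : ℕ) (hN : 0 < N) (ar ac : Fin n' → Fin s → ℤ)
    (har : ∀ k i, (N : ℤ) * Λ i (Sum.inl (Fin.castAdd s k)) =
      ∑ j, ar k j * (Λ i (Sum.inl (Fin.natAdd n' j)) - Λ i (Sum.inr (Fin.natAdd n' j))))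
    (hac : ∀ l i, (N : ℤ) * Λ i (Sum.inr (Fin.castAdd s l)) =
      ∑ j, ac l j * (Λ i (Sum.inl (Fin.natAdd n' j)) - Λ i (Sum.inr (Fin.natAdd n' j))))
    (hfree : ∀ k l, MvPolynomial.coeff (Finsupp.single (Fin.castAdd s k, Fin.castAdd s l) 1) q = 0)
    (p₀ : Fin (n' + s) × Fin (n' + s)) (hp₀ : MvPolynomial.coeff (Finsupp.single p₀ 1) q ≠ 0)
    (hpin : (∃ j, p₀ = (Fin.natAdd n' j, Fin.natAdd n' j)) ∨
      (∃ (j₀ : Fin s) (l₀ : Fin n') (α : ℤ), p₀ = (Fin.natAdd n' j₀, Fin.castAdd s l₀) ∧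
        (∀ k, ar k j₀ = α) ∧ (∀ l, l ≠ l₀ → ac l j₀ = α) ∧ ac l₀ j₀ = α + N) ∨
      (∃ (k₀ : Fin n') (j₀ : Fin s) (α : ℤ), p₀ = (Fin.castAdd s k₀, Fin.natAdd n' j₀) ∧
        (∀ l, ac l j₀ = α) ∧ (∀ k, k ≠ k₀ → ar k j₀ = α) ∧ ar k₀ j₀ + N = α) ∨
      (∃ (j₀ j₁ : Fin s) (α₀ α₁ : ℤ), j₀ ≠ j₁ ∧ p₀ = (Fin.natAdd n' j₀, Fin.natAdd n' j₁) ∧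
        (∀ k, ar k j₀ = α₀) ∧ (∀ l, ac l j₀ = α₀) ∧ (∀ k, ar k j₁ = α₁) ∧ (∀ l, ac l j₁ = α₁))) :
    ∃ B' : Matrix (Fin m) (Fin m) (MvPolynomial (Fin n' × Fin n') ℂ),
      IsEquivariantDetRepr (Subgroup.closure
        {γ : Matrix.GeneralLinearGroup (Fin n' × Fin n') ℂ | ∃ d e : Fin n' → ℂˣ,
          (∀ i : Fin 1, (∏ k, (d k) ^ ((fun (_ : Fin 1) (_ : Fin n' ⊕ Fin n') => (1 : ℤ)) i (Sum.inl k))) *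
            (∏ l, (e l) ^ ((fun (_ : Fin 1) (_ : Fin n' ⊕ Fin n') => (1 : ℤ)) i (Sum.inr l))) = 1) ∧
          (γ : Matrix (Fin n' × Fin n') (Fin n' × Fin n') ℂ) = Matrix.diagonal (fun p => (d p.1 : ℂ) * (e p.2 : ℂ))})
        (perPoly (Fin n') ℂ) B' := by
  classical
  -- `p₀` is not in the free block
  have hp₀free : ∀ k l, p₀ ≠ (Fin.castAdd s k, Fin.castAdd s l) := by
    intro k l h
    rcases hpin with ⟨j, rfl⟩ | ⟨j₀, l₀, α, rfl, -⟩ | ⟨k₀, j₀, α, rfl, -⟩ | ⟨j₀, j₁, α₀, α₁, -, rfl, -⟩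
    · exact natAdd_ne_castAdd k j (congrArg Prod.fst h)
    · exact natAdd_ne_castAdd k j₀ (congrArg Prod.fst h)
    · exact natAdd_ne_castAdd l j₀ (congrArg Prod.snd h)
    · exact natAdd_ne_castAdd k j₀ (congrArg Prod.fst h)
  -- (1) the unpinned substitution: free block kept, sacrificed diagonal `1`, the rest `0`
  let g₀ : Fin (n' + s) × Fin (n' + s) → MvPolynomial (Fin n' × Fin n') ℂ := fun p =>
    Fin.addCases (motive := fun _ => MvPolynomial (Fin n' × Fin n') ℂ)
      (fun k => Fin.addCases (motive := fun _ => MvPolynomial (Fin n' × Fin n') ℂ)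
        (fun l => X (k, l)) (fun _ => 0) p.2)
      (fun j => Fin.addCases (motive := fun _ => MvPolynomial (Fin n' × Fin n') ℂ)
        (fun _ => 0) (fun j' => if j = j' then 1 else 0) p.2)
      p.1
  have hg₀₁ : ∀ k l, g₀ (Fin.castAdd s k, Fin.castAdd s l) = X (k, l) := fun k l => by simp [g₀]
  have hg₀₂ : ∀ k j, g₀ (Fin.castAdd s k, Fin.natAdd n' j) = 0 := fun k j => by simp [g₀]
  have hg₀₃ : ∀ j l, g₀ (Fin.natAdd n' j, Fin.castAdd s l) = 0 := fun j l => by simp [g₀]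
  have hg₀₄ : ∀ j j', g₀ (Fin.natAdd n' j, Fin.natAdd n' j') = if j = j' then 1 else 0 :=
    fun j j' => by simp [g₀]
  -- its constants
  let c₀ : Fin (n' + s) × Fin (n' + s) → ℂ := fun p => coeff 0 (g₀ p)
  have hg₀C : ∀ p, (∀ k l, p ≠ (Fin.castAdd s k, Fin.castAdd s l)) → g₀ p = C (c₀ p) := by
    rintro ⟨a, b⟩ hp
    induction a using Fin.addCases with
    | left k =>
      induction b using Fin.addCases with
      | left l => exact absurd rfl (hp k l)
      | right j => simp [c₀, hg₀₂]
    | right j =>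
      induction b using Fin.addCases with
      | left l => simp [c₀, hg₀₃]
      | right j' =>
        rw [hg₀₄]
        split_ifs <;> simp [c₀, *]
  have hvars : ∀ p ∈ q.vars, g₀ p = C (c₀ p) := by
    intro p hp
    refine hg₀C p fun k l hpk => ?_
    have := coeff_single_ne_zero_of_mem_vars hq hp
    rw [hpk] at this
    exact this (hfree k l)
  -- (2) the pin
  obtain ⟨u₀, κ, hu₀, hκ, hqg⟩ := exists_pin_aeval_eq_C_ne_zero q hq g₀ c₀ hvars p₀ hp₀
  set g : Fin (n' + s) × Fin (n' + s) → MvPolynomial (Fin n' × Fin n') ℂ :=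
    Function.update g₀ p₀ (C u₀) with hg
  have hgp₀ : g p₀ = C u₀ := by simp [hg]
  have hgne : ∀ p, p ≠ p₀ → g p = g₀ p := fun p hp => by simp [hg, Function.update_of_ne hp]
  have hg₁ : ∀ k l, g (Fin.castAdd s k, Fin.castAdd s l) = X (k, l) := fun k l => by
    rw [hgne _ (Ne.symm (hp₀free k l)), hg₀₁]
  -- constants of `g`
  let c : Fin (n' + s) × Fin (n' + s) → ℂ := fun p => coeff 0 (g p)
  have hgC : ∀ p, (∀ k l, p ≠ (Fin.castAdd s k, Fin.castAdd s l)) → g p = C (c p) := by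
    intro p hp
    by_cases hpp : p = p₀
    · subst hpp; simp [c, hgp₀]
    · rw [hgne p hpp]
      have := hg₀C p hp
      simp only [c, hgne p hpp]
      exact this
  have hg₂ : ∀ k j, g (Fin.castAdd s k, Fin.natAdd n' j) = C (c (Fin.castAdd s k, Fin.natAdd n' j)) :=
    fun k j => hgC _ fun k' l h => natAdd_ne_castAdd l j (congrArg Prod.snd h)
  have hg₃ : ∀ j l, g (Fin.natAdd n' j, Fin.castAdd s l) = C (c (Fin.natAdd n' j, Fin.castAdd s l)) :=
    fun j l => hgC _ fun k l' h => natAdd_ne_castAdd k j (congrArg Prod.fst h)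
  have hg₄ : ∀ j j', g (Fin.natAdd n' j, Fin.natAdd n' j') = C (c (Fin.natAdd n' j, Fin.natAdd n' j')) :=
    fun j j' => hgC _ fun k l h => natAdd_ne_castAdd k j (congrArg Prod.fst h)
  -- where a NON-ZERO constant can sit: at the pin or on the sacrificed diagonal
  have hcne : ∀ p, (∀ k l, p ≠ (Fin.castAdd s k, Fin.castAdd s l)) → c p ≠ 0 →
      p = p₀ ∨ ∃ j, p = (Fin.natAdd n' j, Fin.natAdd n' j) := by
    rintro ⟨a, b⟩ hp hc0
    by_cases hpp : (a, b) = p₀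
    · exact Or.inl hpp
    · right
      have hval : g (a, b) = g₀ (a, b) := hgne _ hpp
      have hc' : c (a, b) = coeff 0 (g₀ (a, b)) := by simp only [c, hval]
      rw [hc'] at hc0
      induction a using Fin.addCases with
      | left k =>
        induction b using Fin.addCases with
        | left l => exact absurd rfl (hp k l)
        | right j => rw [hg₀₂] at hc0; simp at hc0
      | right j =>
        induction b using Fin.addCases with
        | left l => rw [hg₀₃] at hc0; simp at hc0
        | right j' =>
          rw [hg₀₄] at hc0
          by_cases hjj : j = j'
          · subst hjj; exact ⟨j, rfl⟩
          · rw [if_neg hjj] at hc0; simp at hc0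
  -- degrees
  have hgdeg : ∀ p, (g p).totalDegree ≤ 1 := by
    intro p
    by_cases hpp : p = p₀
    · rw [hpp, hgp₀, totalDegree_C]; exact zero_le_one
    · rw [hgne p hpp]
      obtain ⟨a, b⟩ := p
      induction a using Fin.addCases <;> induction b using Fin.addCases
      · rw [hg₀₁]; exact (totalDegree_X _).le
      · rw [hg₀₂]; simp
      · rw [hg₀₃]; simp
      · rw [hg₀₄]; split_ifs <;> simp
  -- (3) the substituted permanent: `aeval g per_{n'+s} = C T * per_{n'}`, `T ≠ 0`
  have hper : ∃ T : ℂ, T ≠ 0 ∧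
      MvPolynomial.aeval g (perPoly (Fin (n' + s)) ℂ) = C T * perPoly (Fin n') ℂ := by
    rcases hpin with ⟨j₁, hp⟩ | ⟨j₀, l₀, α, hp, -⟩ | ⟨k₀, j₀, α, hp, -⟩ | ⟨j₀, j₁, α₀, α₁, hne, hp, -⟩
    · -- pin on the sacrificed diagonal: `t = 1` except `t j₁ = u₀`
      refine ⟨∏ j, Function.update (fun _ : Fin s => (1 : ℂ)) j₁ u₀ j, ?_, ?_⟩
      · rw [Finset.prod_update_of_mem (Finset.mem_univ j₁)]
        simp [hu₀]
      · refine aeval_perPoly_absorbing_diag n' s g _ hg₁ (fun j l => ?_) (fun j j' => ?_)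
        · rw [hgne _ (by rw [hp]; exact fun h => natAdd_ne_castAdd l j₁ (congrArg Prod.snd h).symm), hg₀₃]
        · by_cases hjj : j = j'
          · subst hjj
            rw [if_pos rfl]
            by_cases hj1 : j = j₁
            · subst hj1
              rw [← hp, hgp₀, Function.update_self]
            · rw [hgne _ (by rw [hp]; exact fun h => hj1 (Fin.natAdd_injective _ _ (congrArg Prod.fst h))),
                hg₀₄, if_pos rfl, Function.update_of_ne hj1, C_1]
          · rw [if_neg hjj, hgne _ (by rw [hp]; exact fun h => hjj ((Fin.natAdd_injective _ _
              (congrArg Prod.fst h)).trans (Fin.natAdd_injective _ _ (congrArg Prod.snd h)).symm)),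
              hg₀₄, if_neg hjj]
    · -- pin in a sacrificed row and a free column: absorbing, row form
      refine ⟨∏ _j : Fin s, (1 : ℂ), by simp, ?_⟩
      refine aeval_perPoly_absorbing_row n' s g (fun _ => 1) j₀ hg₁ (fun k j => ?_) (fun j => ?_)
        (fun j j' hjj _ => ?_)
      · rw [hgne _ (by rw [hp]; exact fun h => natAdd_ne_castAdd k j₀ (congrArg Prod.fst h).symm), hg₀₂]
      · rw [hgne _ (by rw [hp]; exact fun h => natAdd_ne_castAdd l₀ j (congrArg Prod.snd h)), hg₀₄,
          if_pos rfl, C_1]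
      · rw [hgne _ (by rw [hp]; exact fun h => natAdd_ne_castAdd l₀ j' (congrArg Prod.snd h)), hg₀₄,
          if_neg hjj]
    · -- pin in a free row and a sacrificed column: absorbing, diagonal form
      refine ⟨∏ _j : Fin s, (1 : ℂ), by simp, ?_⟩
      refine aeval_perPoly_absorbing_diag n' s g (fun _ => 1) hg₁ (fun j l => ?_) (fun j j' => ?_)
      · rw [hgne _ (by rw [hp]; exact fun h => natAdd_ne_castAdd k₀ j (congrArg Prod.fst h)), hg₀₃]
      · rw [hgne _ (by rw [hp]; exact fun h => natAdd_ne_castAdd k₀ j (congrArg Prod.fst h)), hg₀₄]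
        split_ifs <;> simp
    · -- pin off the diagonal of the sacrificed block, column `j₁`: absorbing, column form
      refine ⟨∏ _j : Fin s, (1 : ℂ), by simp, ?_⟩
      refine aeval_perPoly_absorbing_col n' s g (fun _ => 1) j₁ hg₁ (fun j l => ?_) (fun j => ?_)
        (fun j j' hjj hj1 => ?_)
      · rw [hgne _ (by rw [hp]; exact fun h => natAdd_ne_castAdd l j₁ (congrArg Prod.snd h).symm), hg₀₃]
      · rw [hgne _ (by rw [hp]; exact fun h => hne ((Fin.natAdd_injective _ _ (congrArg Prod.fst h)).symm.trans
          (Fin.natAdd_injective _ _ (congrArg Prod.snd h)))), hg₀₄, if_pos rfl, C_1]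
      · rw [hgne _ (by rw [hp]; exact fun h => hj1 (Fin.natAdd_injective _ _ (congrArg Prod.snd h))), hg₀₄,
          if_neg hjj]
  obtain ⟨T, hT0, hperT⟩ := hper
  -- (4) the substituted representation
  set B₁ : Matrix (Fin m) (Fin m) (MvPolynomial (Fin n' × Fin n') ℂ) := B.map (MvPolynomial.aeval g) with hB₁
  have hB₁aff : IsAffineDetRepr (C (T * κ) * perPoly (Fin n') ℂ) B₁ := by
    refine ⟨fun i j => ?_, ?_⟩
    · rw [hB₁, Matrix.map_apply]
      exact totalDegree_aeval_le_one g hgdeg _ (hB.1.1 i j)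
    · rw [hB₁, ← AlgHom.mapMatrix_apply, ← AlgHom.map_det, hB.1.2, map_mul, hperT, hqg, map_mul]
      ring
  -- (5) lifts of the per-invariant torus `T¹`
  have hS : ∀ γ' ∈ {γ : Matrix.GeneralLinearGroup (Fin n' × Fin n') ℂ | ∃ d e : Fin n' → ℂˣ,
          (∀ i : Fin 1, (∏ k, (d k) ^ ((fun (_ : Fin 1) (_ : Fin n' ⊕ Fin n') => (1 : ℤ)) i (Sum.inl k))) *
            (∏ l, (e l) ^ ((fun (_ : Fin 1) (_ : Fin n' ⊕ Fin n') => (1 : ℤ)) i (Sum.inr l))) = 1) ∧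
          (γ : Matrix (Fin n' × Fin n') (Fin n' × Fin n') ℂ) = Matrix.diagonal (fun p => (d p.1 : ℂ) * (e p.2 : ℂ))},
      ∃ (d' e' : Fin n' → ℂ) (d e : Fin (n' + s) → ℂˣ),
      (γ' : Matrix (Fin n' × Fin n') (Fin n' × Fin n') ℂ) = Matrix.diagonal (fun p => d' p.1 * e' p.2) ∧
      (∀ i, (∏ k, (d k) ^ (Λ i (Sum.inl k))) * (∏ l, (e l) ^ (Λ i (Sum.inr l))) = 1) ∧
      (∀ k l, (d (Fin.castAdd s k) : ℂ) * (e (Fin.castAdd s l) : ℂ) = d' k * e' l) ∧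
      (∀ k j, (fun k j => c (Fin.castAdd s k, Fin.natAdd n' j)) k j ≠ 0 →
        (d (Fin.castAdd s k) : ℂ) * (e (Fin.natAdd n' j) : ℂ) = 1) ∧
      (∀ j l, (fun j l => c (Fin.natAdd n' j, Fin.castAdd s l)) j l ≠ 0 →
        (d (Fin.natAdd n' j) : ℂ) * (e (Fin.castAdd s l) : ℂ) = 1) ∧
      (∀ j j', (fun j j' => c (Fin.natAdd n' j, Fin.natAdd n' j')) j j' ≠ 0 →
        (d (Fin.natAdd n' j) : ℂ) * (e (Fin.natAdd n' j') : ℂ) = 1) := by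
    rintro γ' ⟨δ, ε, hδε, hγ'⟩
    have hδε1 : (∏ k, δ k) * (∏ l, ε l) = 1 := by
      have := hδε 0
      simpa only [zpow_one] using this
    obtain ⟨dr, er, hdr, her, hprod⟩ := exists_roots_prod_eq_one hn' hN δ ε hδε1
    -- the extension with the pin equation, per case
    have hext : ∃ d e : Fin (n' + s) → ℂˣ,
        (∀ i, (∏ k, (d k) ^ (Λ i (Sum.inl k))) * (∏ l, (e l) ^ (Λ i (Sum.inr l))) = 1) ∧
        (∀ k, d (Fin.castAdd s k) = dr k ^ N) ∧ (∀ l, e (Fin.castAdd s l) = er l ^ N) ∧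
        (∀ j, d (Fin.natAdd n' j) * e (Fin.natAdd n' j) = 1) ∧
        d p₀.1 * e p₀.2 = 1 := by
      have hpow : ∀ (f : Fin n' → ℂˣ) (α : ℤ), (∏ k, f k ^ α) = (∏ k, f k) ^ α :=
        fun f α => Finset.prod_zpow f _ α
      rcases hpin with ⟨j₁, hp⟩ | ⟨j₀, l₀, α, hp, hα1, hα2, hα3⟩ | ⟨k₀, j₀, α, hp, hα1, hα2, hα3⟩ |
          ⟨j₀, j₁, α₀, α₁, hne, hp, h1, h2, h3, h4⟩
      · obtain ⟨d, e, hrel, hd, he, hds, hpq⟩ :=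
          torusExtension_pin_offDiag n' s r Λ N ar ac har hac dr er j₁ j₁ rfl
        exact ⟨d, e, hrel, hd, he, hds, by rw [hp]; exact hpq⟩
      · have hχ : er l₀ ^ N = (∏ k, dr k ^ ar k j₀) * (∏ l, er l ^ ac l j₀) := by
          have h1 : (∏ k, dr k ^ ar k j₀) = (∏ k, dr k) ^ α := by
            rw [← hpow]; exact Finset.prod_congr rfl fun k _ => by rw [hα1 k]
          have h2 : (∏ l, er l ^ ac l j₀) = er l₀ ^ (N : ℤ) * (∏ l, er l) ^ α := by
            rw [← hpow, ← Finset.mul_prod_erase _ _ (Finset.mem_univ l₀),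
              ← Finset.mul_prod_erase _ (fun l => er l ^ α) (Finset.mem_univ l₀), hα3, _root_.zpow_add,
              Finset.prod_congr rfl fun l hl => by rw [hα2 l (Finset.ne_of_mem_erase hl)]]
            simp only [mul_left_comm, mul_assoc]
          rw [h1, h2, mul_left_comm, ← _root_.mul_zpow, hprod, _root_.one_zpow, mul_one, zpow_natCast]
        obtain ⟨d, e, hrel, hd, he, hds, hpq⟩ :=
          torusExtension_pin_sacRow_freeCol n' s r Λ N ar ac har hac dr er j₀ l₀ hχ
        exact ⟨d, e, hrel, hd, he, hds, by rw [hp]; exact hpq⟩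
      · have hχ : dr k₀ ^ N * ((∏ k, dr k ^ ar k j₀) * (∏ l, er l ^ ac l j₀)) = 1 := by
          have h2 : (∏ l, er l ^ ac l j₀) = (∏ l, er l) ^ α := by
            rw [← hpow]; exact Finset.prod_congr rfl fun l _ => by rw [hα1 l]
          have h1 : (∏ k, dr k ^ ar k j₀) = dr k₀ ^ (-(N : ℤ)) * (∏ k, dr k) ^ α := by
            rw [← hpow, ← Finset.mul_prod_erase _ _ (Finset.mem_univ k₀),
              ← Finset.mul_prod_erase _ (fun k => dr k ^ α) (Finset.mem_univ k₀),
              show ar k₀ j₀ = -(N : ℤ) + α by rw [← hα3]; ring, _root_.zpow_add,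
              Finset.prod_congr rfl fun k hk => by rw [hα2 k (Finset.ne_of_mem_erase hk)]]
            simp only [mul_comm, mul_left_comm, mul_assoc]
          rw [h1, h2, mul_assoc, ← _root_.mul_zpow, hprod, _root_.one_zpow, mul_one, zpow_neg, zpow_natCast,
            mul_inv_cancel]
        obtain ⟨d, e, hrel, hd, he, hds, hpq⟩ :=
          torusExtension_pin_freeRow_sacCol n' s r Λ N ar ac har hac dr er k₀ j₀ hχ
        exact ⟨d, e, hrel, hd, he, hds, by rw [hp]; exact hpq⟩
      · have hχ : (∏ k, dr k ^ ar k j₀) * (∏ l, er l ^ ac l j₀) =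
            (∏ k, dr k ^ ar k j₁) * (∏ l, er l ^ ac l j₁) := by
          have q1 : (∏ k, dr k ^ ar k j₀) = (∏ k, dr k) ^ α₀ := by
            rw [← hpow]; exact Finset.prod_congr rfl fun k _ => by rw [h1 k]
          have q2 : (∏ l, er l ^ ac l j₀) = (∏ l, er l) ^ α₀ := by
            rw [← hpow]; exact Finset.prod_congr rfl fun l _ => by rw [h2 l]
          have q3 : (∏ k, dr k ^ ar k j₁) = (∏ k, dr k) ^ α₁ := by
            rw [← hpow]; exact Finset.prod_congr rfl fun k _ => by rw [h3 k]
          have q4 : (∏ l, er l ^ ac l j₁) = (∏ l, er l) ^ α₁ := by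
            rw [← hpow]; exact Finset.prod_congr rfl fun l _ => by rw [h4 l]
          rw [q1, q2, q3, q4, ← _root_.mul_zpow, ← _root_.mul_zpow, hprod, _root_.one_zpow,
            _root_.one_zpow]
        obtain ⟨d, e, hrel, hd, he, hds, hpq⟩ :=
          torusExtension_pin_offDiag n' s r Λ N ar ac har hac dr er j₀ j₁ hχ
        exact ⟨d, e, hrel, hd, he, hds, by rw [hp]; exact hpq⟩
    obtain ⟨d, e, hrel, hd, he, hds, hpq⟩ := hext
    refine ⟨fun k => (δ k : ℂ), fun l => (ε l : ℂ), d, e, hγ', hrel, fun k l => ?_, fun k j hc0 => ?_,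
      fun j l hc0 => ?_, fun j j' hc0 => ?_⟩
    · simp only [hd, he, ← hdr k, ← her l]
    · -- a non-zero constant in the free-row × sacrificed-column block is the pin
      rcases hcne _ (fun k' l h => natAdd_ne_castAdd l j (congrArg Prod.snd h)) hc0 with h | ⟨j', h⟩
      · have := congrArg Units.val hpq
        rw [← h] at this
        simpa using this
      · exact absurd (congrArg Prod.fst h) (natAdd_ne_castAdd k j').symm
    · rcases hcne _ (fun k l' h => natAdd_ne_castAdd k j (congrArg Prod.fst h)) hc0 with h | ⟨j', h⟩
      · have := congrArg Units.val hpq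
        rw [← h] at this
        simpa using this
      · exact absurd (congrArg Prod.snd h) (natAdd_ne_castAdd l j').symm
    · rcases hcne _ (fun k l h => natAdd_ne_castAdd k j (congrArg Prod.fst h)) hc0 with h | ⟨j'', h⟩
      · have := congrArg Units.val hpq
        rw [← h] at this
        simpa using this
      · have hj : j = j'' := Fin.natAdd_injective _ _ (congrArg Prod.fst h)
        have hj' : j' = j'' := Fin.natAdd_injective _ _ (congrArg Prod.snd h)
        rw [hj, hj']
        have := congrArg Units.val (hds j'')
        simpa using this
  have hequiv := isEquivariantDetRepr_subst_const n' s r m Λ (perPoly (Fin (n' + s)) ℂ * q)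
    (C (T * κ) * perPoly (Fin n') ℂ) B g (fun k j => c (Fin.castAdd s k, Fin.natAdd n' j))
    (fun j l => c (Fin.natAdd n' j, Fin.castAdd s l)) (fun j j' => c (Fin.natAdd n' j, Fin.natAdd n' j'))
    hg₁ hg₂ hg₃ hg₄ hB hB₁aff _ hS
  -- (6) rescale the constant away
  exact exists_rescale_C (mul_ne_zero hT0 hκ) hequiv hm

end Summit.ValiantsHypothesis.ValiantsHypothesis.Theorems.FreeSubtorusOrbitDimensionBound.AbsorbingSacrifice

end
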